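import Mathlib.Analysis.InnerProductSpace.Spectrum
import Mathlib.Analysis.InnerProductSpace.PiL2
import Literature.Analysis.FluidPDE.FiniteFourierModeEulerPlanarVert
import Literature.Analysis.FluidPDE.FiniteFourierModeEulerPlanarNorm

/-!
# Kishimoto–Yoneda §3 (planar case), Prop. 3.1 (ii): the vertical component is stationary

Support file for `FiniteFourierModeEuler` (N. Kishimoto, T. Yoneda, J. Math. Fluid Mech. 24
(2022) 74 = arXiv:2110.08039), §3 Prop. 3.1 (ii) ("`u^⊥(t,x)` is also independent of `t`").
With `u^∥` stationary (Prop. 3.1 (i), `FiniteFourierModeEulerPlanarNorm`) the vertical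
coefficients `w(t) = (u^⊥_n(t))_{n ∈ S}` solve the LINEAR system `w' = -B w` (`planarOp`) on the
finite-dimensional space `ℂ^S`, subject to the constraints `(A w)_n = 0` at unoccupied `n`. The
operator `B` is skew-Hermitian for the standard inner product ("`(u^∥·∇)` is anti-symmetric":
`u_{-m} = conj u_m`, `m·u_m = 0`), the span `W` of the trajectory is `B`-invariant, and every
eigenvector of the Hermitian operator `iB|_W` extends by zero to a finitely supported eigenvector of
the full transport `A`; by Lemma 3.3 (`no_eigenvector`) its eigenvalue vanishes. Hence `B|_W = 0`,
`w' = 0`, and `u^⊥` is independent of time (`PlanarCfg.vert_const`). This replaces the paper's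
explicit representation `u^⊥ = Q(ω) - ⟨Q(ω)⟩` (only its consequence, stationarity, is needed).

## References

* [KishimotoYoneda2022] N. Kishimoto, T. Yoneda, J. Math. Fluid Mech. 24 (2022) 74 =
  arXiv:2110.08039, §3 Prop. 3.1 (ii), Lemmas 3.2, 3.3.
-/

noncomputable section

open Matrix Finset Complex
open scoped InnerProductSpace ComplexConjugate

namespace Literature.Analysis.FluidPDE

namespace KY

open scoped Classical

/-! ### Reindexing the pair sum -/

/-- The pair sum of `planarOp` as a single sum. [folklore] -/
theorem planarOp_eq_sum (S : Finset (Fin 3 → ℝ)) (e : Fin 3 → ℝ) (α x : (Fin 3 → ℝ) → ℂ) (n : Fin 3 → ℝ) :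
    planarOp S e α x n = Complex.I * ∑ m ∈ S,
      (if n - m ∈ S then ((pc e (n - m) m : ℝ) : ℂ) * α (n - m) * x m else 0) := by
  unfold planarOp
  congr 1
  rw [← Finset.sum_filter]
  apply Finset.sum_nbij' (fun q => q.2) (fun m => (n - m, m))
  · rintro ⟨a, b⟩ hq
    simp only [Finset.mem_filter, Finset.mem_product] at hq ⊢
    obtain ⟨⟨ha, hb⟩, hab⟩ := hq
    exact ⟨hb, by rw [← hab, add_sub_cancel_right]; exact ha⟩
  · intro m hm
    simp only [Finset.mem_filter, Finset.mem_product] at hm ⊢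
    exact ⟨⟨hm.2, hm.1⟩, by abel⟩
  · rintro ⟨a, b⟩ hq
    simp only [Finset.mem_filter, Finset.mem_product] at hq
    obtain ⟨-, hab⟩ := hq
    simp [← hab]
  · intro m _; rfl
  · rintro ⟨a, b⟩ hq
    simp only [Finset.mem_filter, Finset.mem_product] at hq
    obtain ⟨-, hab⟩ := hq
    simp [← hab]

namespace PlanarCfg

variable {I : Set ℝ} {S : Finset (Fin 3 → ℝ)} {u : (Fin 3 → ℝ) → ℝ → (Fin 3 → ℂ)}
  {e : Fin 3 → ℝ} {S_h : Finset (Fin 3 → ℝ)} (P : PlanarCfg I S u e S_h)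
  (hspan : ∃ a ∈ S_h, ∃ b ∈ S_h, pc e a b ≠ 0) {t₀ : ℝ} (ht₀ : t₀ ∈ I)
include P hspan ht₀

/-- The (stationary) horizontal coefficients. [cite: KishimotoYoneda2022, §3 Prop. 3.1 (i)] -/
def α₀ (e : Fin 3 → ℝ) (u : (Fin 3 → ℝ) → ℝ → (Fin 3 → ℂ)) (t₀ : ℝ) (m : Fin 3 → ℝ) : ℂ := hcoef e m (u m t₀)

omit P hspan ht₀ in
/-- Bookkeeping: `α₀_def`. [folklore] -/
theorem α₀_def (m : Fin 3 → ℝ) : α₀ e u t₀ m = hcoef e m (u m t₀) := rfl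

/-- Coordinate identity `hcoef_eq_α₀`. [folklore] -/
theorem hcoef_eq_α₀ (m : Fin 3 → ℝ) {t : ℝ} (ht : t ∈ I) : hcoef e m (u m t) = α₀ e u t₀ m :=
  P.hcoef_const hspan m ht ht₀

/-- The vertical family. [cite: KishimotoYoneda2022, §3 (`u^⊥_n(t)`)] -/
def wv (e : Fin 3 → ℝ) (u : (Fin 3 → ℝ) → ℝ → (Fin 3 → ℂ)) (t : ℝ) (m : Fin 3 → ℝ) : ℂ := vert e (u m t)

omit hspan ht₀ in
/-- Bookkeeping: `wv_of_notMem`. [folklore] -/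
theorem wv_of_notMem {m : Fin 3 → ℝ} (hm : m ∉ S) (t : ℝ) : wv e u t m = 0 := by
  unfold wv; rw [P.sol.eq_zero_of_notMem m hm t, vert_zero]

/-- The transport operator with the stationary coefficients. [folklore] -/
theorem planarOp_α (x : (Fin 3 → ℝ) → ℂ) (n : Fin 3 → ℝ) {t : ℝ} (ht : t ∈ I) :
    planarOp S e (fun m => hcoef e m (u m t)) x n = planarOp S e (α₀ e u t₀) x n := by
  unfold planarOp
  congr 1
  refine Finset.sum_congr rfl fun q _ => ?_
  simp only [P.hcoef_eq_α₀ hspan ht₀ q.1 ht]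

/-- **(cond:Euler^h) with stationary coefficients: `w' = -A w`.** [cite: KishimotoYoneda2022, §3 (cond:Euler^h)] -/
theorem deriv_wv (n : Fin 3 → ℝ) {t : ℝ} (ht : t ∈ I) :
    deriv (fun s => wv e u s n) t = -planarOp S e (α₀ e u t₀) (wv e u t) n := by
  have := P.deriv_vert_eq n ht
  unfold wv
  rw [this, P.planarOp_α hspan ht₀ _ n ht]

/-- The constraint at unoccupied frequencies. [cite: KishimotoYoneda2022, §3 (cond:Euler^h)] -/
theorem constraint {n : Fin 3 → ℝ} (hn : n ∉ S) {t : ℝ} (ht : t ∈ I) :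
    planarOp S e (α₀ e u t₀) (wv e u t) n = 0 := by
  rw [← P.planarOp_α hspan ht₀ _ n ht]; exact P.planarOp_eq_zero_of_notMem hn ht

omit hspan ht₀ in
/-- `α₀(-k) = -conj α₀(k)` (reality of `u`). [cite: KishimotoYoneda2022, §3 ("`iα_{j+p/2} = conj(iα_j)`")] -/
theorem α₀_neg (k : Fin 3 → ℝ) : α₀ e u t₀ (-k) = -star (α₀ e u t₀ k) := by
  unfold α₀ hcoef
  rw [P.sol.conj k t₀, map_neg, cplx_neg]
  have hden : dot (-cplx (e ⨯₃ k)) (-cplx (e ⨯₃ k)) = dot (cplx (e ⨯₃ k)) (cplx (e ⨯₃ k)) := by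
    simp [dot_eq]
  have hnum : dot (-cplx (e ⨯₃ k)) (star (u k t₀)) = -star (dot (cplx (e ⨯₃ k)) (u k t₀)) := by
    simp [dot_eq, cplx_apply]; ring
  have hreal : star (dot (cplx (e ⨯₃ k)) (cplx (e ⨯₃ k))) = dot (cplx (e ⨯₃ k)) (cplx (e ⨯₃ k)) := by
    rw [dot_cplx_cplx]; exact Complex.conj_ofReal _
  rw [hden, hnum, neg_div, star_div₀, hreal]

/-! ### The finite-dimensional model `ℂ^S` -/

/-- The coefficient space `ℂ^S`. [folklore] -/
abbrev Esp (S : Finset (Fin 3 → ℝ)) := EuclideanSpace ℂ ↥S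

/-- Restriction to `S`. [folklore] -/
def res (x : (Fin 3 → ℝ) → ℂ) : Esp S := WithLp.toLp 2 fun n : ↥S => x n

/-- Extension by zero. [folklore] -/
def ext (y : Esp S) (n : Fin 3 → ℝ) : ℂ := if h : n ∈ S then y ⟨n, h⟩ else 0

omit P hspan ht₀ in
/-- Bookkeeping: `ext_apply_mem`. [folklore] -/
theorem ext_apply_mem (y : Esp S) {n : Fin 3 → ℝ} (hn : n ∈ S) : ext y n = y ⟨n, hn⟩ := by
  unfold ext; rw [dif_pos hn]

omit P hspan ht₀ in
/-- Bookkeeping: `ext_apply_notMem`. [folklore] -/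
theorem ext_apply_notMem (y : Esp S) {n : Fin 3 → ℝ} (hn : n ∉ S) : ext y n = 0 := by
  unfold ext; rw [dif_neg hn]

omit P hspan ht₀ in
/-- Simp bookkeeping: `res_apply`. [folklore] -/
@[simp] theorem res_apply (x : (Fin 3 → ℝ) → ℂ) (n : ↥S) : res x n = x n := rfl

omit hspan ht₀ in
/-- Bookkeeping: `ext_res_wv`. [folklore] -/
theorem ext_res_wv (t : ℝ) : ext (res (S := S) (wv e u t)) = wv e u t := by
  funext n
  by_cases hn : n ∈ S
  · rw [ext_apply_mem _ hn]; rfl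
  · rw [ext_apply_notMem _ hn, P.wv_of_notMem hn]

omit P hspan ht₀ in
/-- `planarOp` only sees the values on `S`. [folklore] -/
theorem planarOp_ext (α : (Fin 3 → ℝ) → ℂ) (y : Esp S) (n : Fin 3 → ℝ) :
    planarOp S e α (ext y) n = Complex.I * ∑ m : ↥S,
      (if n - m.1 ∈ S then ((pc e (n - m.1) m.1 : ℝ) : ℂ) * α (n - m.1) * y m else 0) := by
  rw [planarOp_eq_sum]
  congr 1
  rw [← Finset.sum_coe_sort S]
  refine Finset.sum_congr rfl fun m _ => ?_
  rw [ext_apply_mem _ m.2]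

/-- The kernel of the operator `B` on `ℂ^S`. [folklore] -/
def kerB (e : Fin 3 → ℝ) (u : (Fin 3 → ℝ) → ℝ → (Fin 3 → ℂ)) (t₀ : ℝ) (n m : ↥S) : ℂ :=
  if n.1 - m.1 ∈ S then ((pc e (n.1 - m.1) m.1 : ℝ) : ℂ) * α₀ e u t₀ (n.1 - m.1) else 0

/-- **The operator `B` on `ℂ^S`** (the compression of the transport `A`). [cite: KishimotoYoneda2022, §3 (cond:Euler^h)] -/
def Bop (S : Finset (Fin 3 → ℝ)) (e : Fin 3 → ℝ) (u : (Fin 3 → ℝ) → ℝ → (Fin 3 → ℂ)) (t₀ : ℝ) :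
    Esp S →ₗ[ℂ] Esp S :=
  Matrix.toEuclideanLin (Matrix.of fun n m : ↥S => Complex.I * kerB e u t₀ n m)

omit P hspan ht₀ in
/-- Bookkeeping: `Bop_apply`. [folklore] -/
theorem Bop_apply (y : Esp S) (n : ↥S) : Bop S e u t₀ y n = Complex.I * ∑ m, kerB e u t₀ n m * y m := by
  unfold Bop
  rw [Matrix.toLpLin_apply]
  simp only [Matrix.mulVec, dotProduct, Matrix.of_apply, Finset.mul_sum]
  refine Finset.sum_congr rfl fun m _ => ?_
  simp only [mul_assoc]

omit P hspan ht₀ in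
/-- `B` is the compression of `A`: `(B y)_n = (A (ext y))_n` for `n ∈ S`. [folklore] -/
theorem Bop_eq_planarOp (y : Esp S) (n : ↥S) : Bop S e u t₀ y n = planarOp S e (α₀ e u t₀) (ext y) n.1 := by
  rw [Bop_apply, planarOp_ext]
  congr 1
  refine Finset.sum_congr rfl fun m _ => ?_
  unfold kerB
  split_ifs <;> simp

omit hspan ht₀ in
/-- The kernel is Hermitian up to the factor `i`: `conj k(n, m) = k(m, n)`. [cite: KishimotoYoneda2022, §3 (anti-symmetry of `u^∥·∇`)] -/
theorem kerB_conj (n m : ↥S) : star (kerB e u t₀ n m) = kerB e u t₀ m n := by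
  unfold kerB
  have hsymm : (n.1 - m.1 ∈ S) ↔ (m.1 - n.1 ∈ S) := by
    constructor <;> intro h <;> simpa using P.sol.neg_mem _ h
  by_cases h : n.1 - m.1 ∈ S
  · rw [if_pos h, if_pos (hsymm.1 h)]
    have e1 : m.1 - n.1 = -(n.1 - m.1) := by abel
    rw [e1, P.α₀_neg, pc_neg_left]
    have e2 : pc e (n.1 - m.1) n.1 = pc e (n.1 - m.1) m.1 := by
      rw [congrArg (pc e (n.1 - m.1)) (show (n.1 : Fin 3 → ℝ) = (n.1 - m.1) + m.1 by abel),
        pc_add_right, pc_self, zero_add]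
    rw [e2, star_mul]
    simp [mul_comm]
  · rw [if_neg h, if_neg (fun h' => h (hsymm.2 h')), star_zero]

omit hspan ht₀ in
/-- **`B` is skew-Hermitian**: `⟪B x, y⟫ = -⟪x, B y⟫`. [cite: KishimotoYoneda2022, §3 ("`∂_t u^⊥ + (u^∥·∇)u^⊥ = 0`", `u^∥` real and divergence-free)] -/
theorem Bop_skew (x y : Esp S) : ⟪Bop S e u t₀ x, y⟫_ℂ = -⟪x, Bop S e u t₀ y⟫_ℂ := by
  have hL : ⟪Bop S e u t₀ x, y⟫_ℂ = ∑ n, ∑ m, (-Complex.I) * (star (kerB e u t₀ n m) * star (x m) * y n) := by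
    simp only [PiLp.inner_apply, RCLike.inner_apply, Bop_apply, map_mul, map_sum, Complex.conj_I,
      Finset.mul_sum]
    refine Finset.sum_congr rfl fun n _ => Finset.sum_congr rfl fun m _ => ?_
    simp only [Complex.star_def]
    ring
  have hR : ⟪x, Bop S e u t₀ y⟫_ℂ = ∑ m, ∑ n, Complex.I * (kerB e u t₀ m n * star (x m) * y n) := by
    simp only [PiLp.inner_apply, RCLike.inner_apply, Bop_apply, Finset.mul_sum, Finset.sum_mul]
    refine Finset.sum_congr rfl fun m _ => Finset.sum_congr rfl fun n _ => ?_
    simp only [Complex.star_def]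
    ring
  rw [hL, hR, Finset.sum_comm, ← Finset.sum_neg_distrib]
  refine Finset.sum_congr rfl fun m _ => ?_
  rw [← Finset.sum_neg_distrib]
  refine Finset.sum_congr rfl fun n _ => ?_
  rw [P.kerB_conj n m]
  ring

/-! ### The span of the trajectory -/

/-- The span `W` of the vertical trajectory. [folklore] -/
def Wsp (I : Set ℝ) (S : Finset (Fin 3 → ℝ)) (e : Fin 3 → ℝ) (u : (Fin 3 → ℝ) → ℝ → (Fin 3 → ℂ)) :
    Submodule ℂ (Esp S) :=
  Submodule.span ℂ (Set.range fun t : I => res (S := S) (wv e u t))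

omit P hspan ht₀ in
/-- Bookkeeping: `res_wv_mem`. [folklore] -/
theorem res_wv_mem {t : ℝ} (ht : t ∈ I) : res (S := S) (wv e u t) ∈ Wsp I S e u :=
  Submodule.subset_span ⟨⟨t, ht⟩, rfl⟩

/-- The pairing `t ↦ ⟪y, w(t)⟫` has derivative `-⟪y, B w(t)⟫`. [folklore] -/
theorem hasDerivAt_inner (y : Esp S) {t : ℝ} (ht : t ∈ I) :
    HasDerivAt (fun s => ⟪y, res (S := S) (wv e u s)⟫_ℂ) (-⟪y, Bop S e u t₀ (res (wv e u t))⟫_ℂ) t := by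
  have hform : (fun s => ⟪y, res (S := S) (wv e u s)⟫_ℂ) = fun s => ∑ n : ↥S, conj (y n) * vert e (u n s) := by
    funext s
    simp only [PiLp.inner_apply, RCLike.inner_apply, res_apply]
    refine Finset.sum_congr rfl fun n _ => ?_
    unfold wv; ring
  rw [hform]
  have hval : -⟪y, Bop S e u t₀ (res (wv e u t))⟫_ℂ
      = ∑ n : ↥S, conj (y n) * (-planarOp S e (α₀ e u t₀) (wv e u t) n) := by
    simp only [PiLp.inner_apply, RCLike.inner_apply, ← Finset.sum_neg_distrib]
    refine Finset.sum_congr rfl fun n _ => ?_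
    rw [Bop_eq_planarOp, P.ext_res_wv]; ring
  rw [hval]
  apply HasDerivAt.fun_sum
  intro n _
  have hd : HasDerivAt (fun s => vert e (u n s)) (deriv (fun s => vert e (u n s)) t) t :=
    ((P.differentiableOn_vert n).differentiableAt (P.sol.isOpen.mem_nhds ht)).hasDerivAt
  have := hd.const_mul (conj (y n))
  rwa [show deriv (fun s => vert e (u n s)) t = -planarOp S e (α₀ e u t₀) (wv e u t) n from
    P.deriv_wv hspan ht₀ n ht] at this

/-- **`B w(t) ∈ W`**: the derivative of the trajectory stays in its span. [folklore] -/
theorem Bop_wv_mem {t : ℝ} (ht : t ∈ I) : Bop S e u t₀ (res (wv e u t)) ∈ Wsp I S e u := by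
  rw [← Submodule.orthogonal_orthogonal (Wsp I S e u), Submodule.mem_orthogonal]
  intro y hy
  -- `s ↦ ⟪y, w(s)⟫` vanishes on `I`
  have hzero : ∀ s ∈ I, ⟪y, res (S := S) (wv e u s)⟫_ℂ = 0 := fun s hs =>
    (Submodule.mem_orthogonal' _ _).1 hy _ (res_wv_mem hs)
  have hd := P.hasDerivAt_inner hspan ht₀ y ht
  have hd0 : HasDerivAt (fun s => ⟪y, res (S := S) (wv e u s)⟫_ℂ) 0 t := by
    refine (hasDerivAt_const t (0 : ℂ)).congr_of_eventuallyEq ?_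
    filter_upwards [P.sol.isOpen.mem_nhds ht] with s hs
    exact hzero s hs
  have := hd.unique hd0
  rw [neg_eq_zero] at this
  exact this

/-- `B` maps `W` into itself. [folklore] -/
theorem Bop_maps : ∀ x ∈ Wsp I S e u, Bop S e u t₀ x ∈ Wsp I S e u := by
  intro x hx
  have : Wsp I S e u ≤ (Wsp I S e u).comap (Bop S e u t₀) := by
    apply Submodule.span_le.2
    rintro _ ⟨⟨t, ht⟩, rfl⟩
    exact P.Bop_wv_mem hspan ht₀ ht
  exact this hx

/-- The constraints hold on all of `W`. [folklore] -/
theorem constraint_W {x : Esp S} (hx : x ∈ Wsp I S e u) {n : Fin 3 → ℝ} (hn : n ∉ S) :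
    planarOp S e (α₀ e u t₀) (ext x) n = 0 := by
  induction hx using Submodule.span_induction with
  | mem y hy =>
    obtain ⟨⟨t, ht⟩, rfl⟩ := hy
    rw [P.ext_res_wv]; exact P.constraint hspan ht₀ hn ht
  | zero =>
    rw [planarOp_ext]; simp
  | add y z _ _ hy hz =>
    have hyz : ext (y + z) = ext (S := S) y + ext z := by
      funext k; by_cases hk : k ∈ S
      · simp [ext_apply_mem _ hk]
      · simp [ext_apply_notMem _ hk]
    rw [hyz]
    unfold planarOp at hy hz ⊢
    rw [mul_eq_zero] at hy hz
    rw [mul_eq_zero]; right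
    have hy' := hy.resolve_left Complex.I_ne_zero
    have hz' := hz.resolve_left Complex.I_ne_zero
    have : (∑ q ∈ (S ×ˢ S).filter (fun q : (Fin 3 → ℝ) × (Fin 3 → ℝ) => q.1 + q.2 = n),
        ((pc e q.1 q.2 : ℝ) : ℂ) * α₀ e u t₀ q.1 * (ext y + ext z) q.2)
        = (∑ q ∈ (S ×ˢ S).filter (fun q : (Fin 3 → ℝ) × (Fin 3 → ℝ) => q.1 + q.2 = n),
            ((pc e q.1 q.2 : ℝ) : ℂ) * α₀ e u t₀ q.1 * ext y q.2)
          + ∑ q ∈ (S ×ˢ S).filter (fun q : (Fin 3 → ℝ) × (Fin 3 → ℝ) => q.1 + q.2 = n),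
            ((pc e q.1 q.2 : ℝ) : ℂ) * α₀ e u t₀ q.1 * ext z q.2 := by
      rw [← Finset.sum_add_distrib]
      refine Finset.sum_congr rfl fun q _ => ?_
      simp only [Pi.add_apply]; ring
    rw [this, hy', hz', add_zero]
  | smul c y _ hy =>
    have hcy : ext (c • y) = c • ext (S := S) y := by
      funext k; by_cases hk : k ∈ S
      · simp [ext_apply_mem _ hk]
      · simp [ext_apply_notMem _ hk]
    rw [hcy]
    unfold planarOp at hy ⊢
    rw [mul_eq_zero] at hy
    rw [mul_eq_zero]; right
    have hy' := hy.resolve_left Complex.I_ne_zero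
    have : (∑ q ∈ (S ×ˢ S).filter (fun q : (Fin 3 → ℝ) × (Fin 3 → ℝ) => q.1 + q.2 = n),
        ((pc e q.1 q.2 : ℝ) : ℂ) * α₀ e u t₀ q.1 * (c • ext y) q.2)
        = c * ∑ q ∈ (S ×ˢ S).filter (fun q : (Fin 3 → ℝ) × (Fin 3 → ℝ) => q.1 + q.2 = n),
          ((pc e q.1 q.2 : ℝ) : ℂ) * α₀ e u t₀ q.1 * ext y q.2 := by
      rw [Finset.mul_sum]
      refine Finset.sum_congr rfl fun q _ => ?_
      simp only [Pi.smul_apply, smul_eq_mul]; ring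
    rw [this, hy', mul_zero]

end PlanarCfg

end KY

end Literature.Analysis.FluidPDE
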